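/-
Copyright (c) 2026 the pub-hodgecm-mathlib formalisation cell (harness21).  Prover seat hodgecm-mathlib-B-p04 (g34) — EP PEN of (R2) (LEAD F0P3a-plan (g9)
WORD T8-167; LEAD F0P3a-plan (g10) WORD T9-8 (C) «B-p04 keeps (R3)(R5)+assembly»), 2026-09-01.  FILE (R5a) of the Euler–Poincaré road for
`stub_N6nsR2EP : RankOneEulerPoincareNonsplit`: the GENERIC fibrewise evaluation of the Iwahori edge count of an elliptic element with an eigenframe.
-/
import Literature.NumberTheory.Automorphic.UnitaryTwoIwahoriStarFixedPoints
import Literature.NumberTheory.Automorphic.FixedPointsQuotientFibration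
import HarnessLib

/-!
# The Iwahori edge count of an elliptic `γ ∈ U(1,1)`, fibrewise: `E(γ) = V(γ) + q · #{scalar-reduction vertices}` (and `E = 0` when `|u₀ − u₁| = 1`)

Topic `NumberTheory/Automorphic`, namespace `Literature.NumberTheory.Automorphic`.  THEOREMS ONLY: no definition, no named fact, no instance, no
notation, no `sorry`; kernel lane.  FILE (R5a) of the EP road (census `CENSUS-R2EP-RankOneEulerPoincare.B-p04g34.md`, bricks (2a)+(2c)+(2e) composed), over
★ `FixedPointsQuotientFibration` (`E(γ) = Σ_{x ∈ Fix_K γ} #Fix_{k_x}(K ⧸ I)`, `k_x = (out x)⁻¹ γ (out x)`) and ★ `UnitaryTwoIwahoriStarFixedPoints` (the star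
counts `q + 1 ∕ 1 ∕ 0` by reduction type) [Kottwitz1988, §2], [Rogawski1990, §12.6–12.7].

THE MATHEMATICS.  `F` a field with a `ValuativeRel`, `σ ∕ σO ∕ τ` an involution with its integral and residual avatars, `ha₀ : IsUnit (σO a₀ − a₀)`
(unramified), `U = U(σ, Φ₂)`, `K = U ∩ GL₂(𝒪)`, `I = U ∩ Iwahori`, and `γ ∈ U` ELLIPTIC with an eigenframe `γ P = P diag(u₀, u₁)`, `uᵢ ∈ 𝒪` of norm one.
For a `γ`-fixed vertex `x ∈ Fix_γ(U ⧸ K)` the monodromy `k_x = (out x)⁻¹ γ (out x) ∈ K` has the eigenframe `(out x)⁻¹ P` with the SAME `u`, so: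
* `natCard_fixedBy_iwahori_eq_zero_of_valuation_sub_eq_one` — if `|u₀ − u₁| = 1` every star count vanishes (★ `…_of_valuation_sub_eq_one`), every fixed
  edge would lie over a fixed vertex with a non-empty fibre (★ `exists_equiv_fiber_fixedBy_quotient`), so `E(γ) = #Fix_γ(U ⧸ I) = 0`;
* `natCard_fixedBy_iwahori_eq_add_mul_of_valuation_sub_lt_one` — if `|u₀ − u₁| < 1` the star count at `x` is `s + 1` (`s = #{t ∈ 𝓀 : τ t = −t}`, `= q`)
  when `k_x ≡ u₁·1 (mod 𝓂)` and `1` otherwise (★ `…_of_scalar`, ★ `…_of_valuation_sub_lt_one`), so for finitely many fixed vertices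
  `E(γ) = #Fix_γ(U ⧸ K) + s · #{x ∈ Fix_γ(U ⧸ K) : k_x ≡ u₁·1 (mod 𝓂)}` (★ `natCard_fixedBy_quotient_eq_sum_of_le` with the section `Quotient.out`).
The CM reading at an unramified non-split place (`#Fix_γ(U ⧸ K) = V(N)`, `#{scalar} = V(N−1)` by ★ B-p10 (L5) ∕ ★ A-p03 (R4), `s = q_v`, whence
`E(γ) + 1 = Σ_{j ≤ N} w(q_v, j)`) is FILE (R5b).  The quotient actions are spelled with explicit `MulAction.quotient` instances, as in ★ (R3c); the
second theorem runs at `maxHeartbeats 400000` (the `Finset.sum_ite` bookkeeping over the fixed-vertex type `↥(fixedBy (↥U ⧸ K_U) γ)` costs ≈ 250k).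
HONEST LABEL: HC_CM is proved only modulo the cell's remaining named inputs (hLiu418, h413) until rung 0 closes; this file is unconditional algebra.

## References
* [Kottwitz1988] R. E. Kottwitz, *Tamagawa numbers*, Ann. of Math. 127 (1988), 629–646, §2 (`O_γ(f_EP) = χ(X^γ)`; fixed edges over fixed vertices).
* [Serre1980Trees] J.-P. Serre, *Trees* (1980), Ch. I §6, Ch. II §1.1.
* [Rogawski1990] J. D. Rogawski, *Automorphic Representations of Unitary Groups in Three Variables* (1990), §12.6–12.7 pp. 174–176 (Lemma 12.7.1).
-/

set_option autoImplicit false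

open scoped ValuativeRel Matrix MatrixGroups
open Matrix ValuativeRel MulAction

namespace Literature.NumberTheory.Automorphic

section Generic

variable {F : Type*} [Field F] [ValuativeRel F] (σ : F →+* F) (σO : 𝒪[F] →+* 𝒪[F])
  (hσO' : ∀ x : 𝒪[F], ((σO x : 𝒪[F]) : F) = σ x) (hσσ : ∀ x, σO (σO x) = x) {a₀ : 𝒪[F]} (ha₀ : IsUnit (σO a₀ - a₀))
  (τ : 𝓀[F] →+* 𝓀[F]) (hτ : ∀ x : 𝒪[F], IsLocalRing.residue 𝒪[F] (σO x) = τ (IsLocalRing.residue 𝒪[F] x))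

/-- `I = U ∩ Iwahori ≤ K = U ∩ GL₂(𝒪)`. [cite: IwahoriMatsumoto1965, §2] -/
theorem iwahori_subgroupOf_le (J : Matrix (Fin 2) (Fin 2) F) :
    (iwahoriGL 2 F).subgroupOf (unitaryGroupOfForm σ J) ≤ (glInt 2 F).subgroupOf (unitaryGroupOfForm σ J) :=
  fun _ hk => Subgroup.mem_subgroupOf.2 (iwahoriGL_le_glInt 2 F (Subgroup.mem_subgroupOf.1 hk))

omit [ValuativeRel F] in
/-- The monodromy `k_x = (out x)⁻¹ γ (out x)` of a fixed vertex has the eigenframe `(out x)⁻¹ P` of `γ`, with the same eigenvalues.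
[cite: Kottwitz1988, §2] -/
theorem conj_mul_eigenframe {J : Matrix (Fin 2) (Fin 2) F} (γ y : ↥(unitaryGroupOfForm σ J)) {P : GL (Fin 2) F} {u : Fin 2 → F}
    (hP : (((γ : ↥(unitaryGroupOfForm σ J)) : GL (Fin 2) F) : Matrix (Fin 2) (Fin 2) F) * P = P * diagonal u) :
    ((((y⁻¹ * γ * y : ↥(unitaryGroupOfForm σ J))) : GL (Fin 2) F) : Matrix (Fin 2) (Fin 2) F) * ((((y : ↥(unitaryGroupOfForm σ J)) : GL (Fin 2) F)⁻¹ * P :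
        GL (Fin 2) F) : Matrix (Fin 2) (Fin 2) F) =
      ((((y : ↥(unitaryGroupOfForm σ J)) : GL (Fin 2) F)⁻¹ * P : GL (Fin 2) F) : Matrix (Fin 2) (Fin 2) F) * diagonal u := by
  have hy : ((((y : ↥(unitaryGroupOfForm σ J)) : GL (Fin 2) F)) : Matrix (Fin 2) (Fin 2) F) *
      ((((y : ↥(unitaryGroupOfForm σ J)) : GL (Fin 2) F)⁻¹ : GL (Fin 2) F) : Matrix (Fin 2) (Fin 2) F) = 1 := by
    rw [← Units.val_mul, mul_inv_cancel, Units.val_one]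
  rw [Subgroup.coe_mul, Subgroup.coe_mul, Subgroup.coe_inv, Units.val_mul, Units.val_mul, Units.val_mul, Matrix.mul_assoc, Matrix.mul_assoc,
    ← Matrix.mul_assoc ((((y : ↥(unitaryGroupOfForm σ J)) : GL (Fin 2) F)) : Matrix (Fin 2) (Fin 2) F), hy, Matrix.one_mul, hP, Matrix.mul_assoc]

include hσO' hσσ ha₀ hτ in
/-- **`E(γ) = 0` WHEN `|u₀ − u₁| = 1`**: for `γ ∈ U(σ, Φ₂)` with eigenframe `γ P = P diag(u)`, `uᵢ ∈ 𝒪` of norm one and `u₀ − u₁` a unit, no edge of the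
tree is `γ`-fixed — every fixed edge lies over a fixed vertex `x`, in a fibre in bijection (★ `exists_equiv_fiber_fixedBy_quotient`) with the star
fixed points of `k_x`, and those are none (★ `natCard_fixedBy_unitaryTwo_star_of_valuation_sub_eq_one`). [cite: Kottwitz1988, §2] -/
theorem natCard_fixedBy_iwahori_eq_zero_of_valuation_sub_eq_one [Finite 𝓀[F]] {J : Matrix (Fin 2) (Fin 2) F} (hJ : J = !![0, 1; 1, 0])
    (γ : ↥(unitaryGroupOfForm σ J)) {P : GL (Fin 2) F} {u : Fin 2 → F}
    (hP : (((γ : ↥(unitaryGroupOfForm σ J)) : GL (Fin 2) F) : Matrix (Fin 2) (Fin 2) F) * P = P * diagonal u) (hu : ∀ i, u i ∈ 𝒪[F])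
    (hu1 : ∀ i, σ (u i) * u i = 1) (h01 : valuation F (u 0 - u 1) = 1) :
    Nat.card (fixedBy (↥(unitaryGroupOfForm σ J) ⧸ (iwahoriGL 2 F).subgroupOf (unitaryGroupOfForm σ J)) γ) = 0 := by
  classical
  letI instK : MulAction (↥((glInt 2 F).subgroupOf (unitaryGroupOfForm σ J))) (↥((glInt 2 F).subgroupOf (unitaryGroupOfForm σ J)) ⧸
      ((iwahoriGL 2 F).subgroupOf (unitaryGroupOfForm σ J)).subgroupOf ((glInt 2 F).subgroupOf (unitaryGroupOfForm σ J))) :=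
    MulAction.quotient _ _
  letI instUK : MulAction (↥(unitaryGroupOfForm σ J)) (↥(unitaryGroupOfForm σ J) ⧸ (glInt 2 F).subgroupOf (unitaryGroupOfForm σ J)) :=
    MulAction.quotient _ _
  letI instUI : MulAction (↥(unitaryGroupOfForm σ J)) (↥(unitaryGroupOfForm σ J) ⧸ (iwahoriGL 2 F).subgroupOf (unitaryGroupOfForm σ J)) :=
    MulAction.quotient _ _
  -- the star is finite
  haveI hfinstar : Finite (↥((glInt 2 F).subgroupOf (unitaryGroupOfForm σ J)) ⧸
      ((iwahoriGL 2 F).subgroupOf (unitaryGroupOfForm σ J)).subgroupOf ((glInt 2 F).subgroupOf (unitaryGroupOfForm σ J))) := by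
    apply Nat.finite_of_card_ne_zero
    rw [natCard_unitaryTwo_star σ σO hσO' hσσ ha₀ τ hτ hJ]
    exact Nat.succ_ne_zero _
  set r : ↥(unitaryGroupOfForm σ J) ⧸ (glInt 2 F).subgroupOf (unitaryGroupOfForm σ J) → ↥(unitaryGroupOfForm σ J) := Quotient.out with hr'
  have hr : Function.RightInverse r QuotientGroup.mk := fun x => Quotient.out_eq x
  rw [Nat.card_eq_zero]
  left
  refine ⟨fun y => ?_⟩
  -- the vertex under `y` and the fibre over it
  set e := Subgroup.quotientEquivProdOfLE' (iwahori_subgroupOf_le σ J) r hr with he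
  have hx : (e y.1).1 ∈ fixedBy (↥(unitaryGroupOfForm σ J) ⧸ (glInt 2 F).subgroupOf (unitaryGroupOfForm σ J)) γ := by
    have h := quotientEquivProdOfLE'_smul_fst (iwahori_subgroupOf_le σ J) r hr γ y.1
    rw [MulAction.mem_fixedBy.1 y.2] at h
    rw [MulAction.mem_fixedBy, he]
    exact h.symm
  set x : fixedBy (↥(unitaryGroupOfForm σ J) ⧸ (glInt 2 F).subgroupOf (unitaryGroupOfForm σ J)) γ := ⟨(e y.1).1, hx⟩ with hxdef
  obtain ⟨Φ⟩ := exists_equiv_fiber_fixedBy_quotient (iwahori_subgroupOf_le σ J) r hr γ x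
  -- the fibre is empty: its star count is `0`
  have h0 := natCard_fixedBy_unitaryTwo_star_of_valuation_sub_eq_one σ σO hσO' hσσ ha₀ τ hτ hJ
    (⟨(r x.1)⁻¹ * γ * r x.1, inv_mul_mul_mem_of_smul_eq r hr γ x.2⟩ : ↥((glInt 2 F).subgroupOf (unitaryGroupOfForm σ J)))
    (P := ((r x.1 : ↥(unitaryGroupOfForm σ J)) : GL (Fin 2) F)⁻¹ * P) (conj_mul_eigenframe σ γ (r x.1) hP) hu hu1 h01
  haveI : Finite (fixedBy (↥((glInt 2 F).subgroupOf (unitaryGroupOfForm σ J)) ⧸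
      ((iwahoriGL 2 F).subgroupOf (unitaryGroupOfForm σ J)).subgroupOf ((glInt 2 F).subgroupOf (unitaryGroupOfForm σ J)))
      (⟨(r x.1)⁻¹ * γ * r x.1, inv_mul_mul_mem_of_smul_eq r hr γ x.2⟩ : ↥((glInt 2 F).subgroupOf (unitaryGroupOfForm σ J)))) :=
    Subtype.finite
  have hempty := (Nat.card_eq_zero.1 h0).resolve_right (not_infinite_iff_finite.2 inferInstance)
  exact hempty.false (Φ ⟨y, rfl⟩)

include hσO' hσσ ha₀ hτ in
set_option maxHeartbeats 400000 in
/-- **`E(γ) = V(γ) + s · #{scalar-reduction vertices}` WHEN `|u₀ − u₁| < 1`** (`s = #{t ∈ 𝓀 : τ t = −t}`): for `γ ∈ U(σ, Φ₂)` with eigenframe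
`γ P = P diag(u)`, `uᵢ ∈ 𝒪` of norm one, `|u₀ − u₁| < 1`, and finitely many `γ`-fixed vertices, the `γ`-fixed edges number
`#Fix_γ(U ⧸ K) + s · #{x ∈ Fix_γ(U ⧸ K) : (out x)⁻¹ γ (out x) ≡ u₁·1 (mod 𝓂)}` — over each fixed vertex the star count is `s + 1` or `1`
(★ `natCard_fixedBy_unitaryTwo_star_of_scalar` ∕ `…_of_valuation_sub_lt_one`), summed by ★ `natCard_fixedBy_quotient_eq_sum_of_le`.
[cite: Kottwitz1988, §2] [cite: Rogawski1990, §12.6 p. 174] -/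
theorem natCard_fixedBy_iwahori_eq_add_mul_of_valuation_sub_lt_one [Finite 𝓀[F]] {J : Matrix (Fin 2) (Fin 2) F} (hJ : J = !![0, 1; 1, 0])
    (γ : ↥(unitaryGroupOfForm σ J)) {P : GL (Fin 2) F} {u : Fin 2 → F}
    (hP : (((γ : ↥(unitaryGroupOfForm σ J)) : GL (Fin 2) F) : Matrix (Fin 2) (Fin 2) F) * P = P * diagonal u) (hu : ∀ i, u i ∈ 𝒪[F])
    (hu1 : ∀ i, σ (u i) * u i = 1) (hlt : valuation F (u 0 - u 1) < 1)
    [Finite (fixedBy (↥(unitaryGroupOfForm σ J) ⧸ (glInt 2 F).subgroupOf (unitaryGroupOfForm σ J)) γ)] :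
    Nat.card (fixedBy (↥(unitaryGroupOfForm σ J) ⧸ (iwahoriGL 2 F).subgroupOf (unitaryGroupOfForm σ J)) γ) =
      Nat.card (fixedBy (↥(unitaryGroupOfForm σ J) ⧸ (glInt 2 F).subgroupOf (unitaryGroupOfForm σ J)) γ) +
        Nat.card {t : 𝓀[F] // τ t = -t} *
          Nat.card {x : fixedBy (↥(unitaryGroupOfForm σ J) ⧸ (glInt 2 F).subgroupOf (unitaryGroupOfForm σ J)) γ //
            ∀ i j, valuation F (((((x.1.out)⁻¹ * γ * x.1.out : ↥(unitaryGroupOfForm σ J)) : GL (Fin 2) F) : Matrix (Fin 2) (Fin 2) F) i j -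
              (u 1 • (1 : Matrix (Fin 2) (Fin 2) F)) i j) < 1} := by
  classical
  letI instK : MulAction (↥((glInt 2 F).subgroupOf (unitaryGroupOfForm σ J))) (↥((glInt 2 F).subgroupOf (unitaryGroupOfForm σ J)) ⧸
      ((iwahoriGL 2 F).subgroupOf (unitaryGroupOfForm σ J)).subgroupOf ((glInt 2 F).subgroupOf (unitaryGroupOfForm σ J))) :=
    MulAction.quotient _ _
  letI : Fintype (fixedBy (↥(unitaryGroupOfForm σ J) ⧸ (glInt 2 F).subgroupOf (unitaryGroupOfForm σ J)) γ) := Fintype.ofFinite _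
  haveI hfinstar : Finite (↥((glInt 2 F).subgroupOf (unitaryGroupOfForm σ J)) ⧸
      ((iwahoriGL 2 F).subgroupOf (unitaryGroupOfForm σ J)).subgroupOf ((glInt 2 F).subgroupOf (unitaryGroupOfForm σ J))) := by
    apply Nat.finite_of_card_ne_zero
    rw [natCard_unitaryTwo_star σ σO hσO' hσσ ha₀ τ hτ hJ]
    exact Nat.succ_ne_zero _
  set r : ↥(unitaryGroupOfForm σ J) ⧸ (glInt 2 F).subgroupOf (unitaryGroupOfForm σ J) → ↥(unitaryGroupOfForm σ J) := Quotient.out with hr'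
  have hr : Function.RightInverse r QuotientGroup.mk := fun x => Quotient.out_eq x
  haveI : ∀ x : fixedBy (↥(unitaryGroupOfForm σ J) ⧸ (glInt 2 F).subgroupOf (unitaryGroupOfForm σ J)) γ,
      Finite (fixedBy (↥((glInt 2 F).subgroupOf (unitaryGroupOfForm σ J)) ⧸
        ((iwahoriGL 2 F).subgroupOf (unitaryGroupOfForm σ J)).subgroupOf ((glInt 2 F).subgroupOf (unitaryGroupOfForm σ J)))
        (⟨(r x.1)⁻¹ * γ * r x.1, inv_mul_mul_mem_of_smul_eq r hr γ x.2⟩ : ↥((glInt 2 F).subgroupOf (unitaryGroupOfForm σ J)))) :=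
    fun x => Subtype.finite
  rw [natCard_fixedBy_quotient_eq_sum_of_le (iwahori_subgroupOf_le σ J) r hr γ]
  -- the star count over each fixed vertex
  have hterm : ∀ x : fixedBy (↥(unitaryGroupOfForm σ J) ⧸ (glInt 2 F).subgroupOf (unitaryGroupOfForm σ J)) γ,
      Nat.card (fixedBy (↥((glInt 2 F).subgroupOf (unitaryGroupOfForm σ J)) ⧸
        ((iwahoriGL 2 F).subgroupOf (unitaryGroupOfForm σ J)).subgroupOf ((glInt 2 F).subgroupOf (unitaryGroupOfForm σ J)))
        (⟨(r x.1)⁻¹ * γ * r x.1, inv_mul_mul_mem_of_smul_eq r hr γ x.2⟩ : ↥((glInt 2 F).subgroupOf (unitaryGroupOfForm σ J)))) =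
      if ∀ i j, valuation F (((((x.1.out)⁻¹ * γ * x.1.out : ↥(unitaryGroupOfForm σ J)) : GL (Fin 2) F) : Matrix (Fin 2) (Fin 2) F) i j -
          (u 1 • (1 : Matrix (Fin 2) (Fin 2) F)) i j) < 1
        then Nat.card {t : 𝓀[F] // τ t = -t} + 1 else 1 := by
    intro x
    split_ifs with h
    · exact natCard_fixedBy_unitaryTwo_star_of_scalar σ σO hσO' hσσ ha₀ τ hτ hJ _ (a := ⟨u 1, hu 1⟩) h
    · exact natCard_fixedBy_unitaryTwo_star_of_valuation_sub_lt_one σ σO hσO' hσσ ha₀ τ hτ hJ _ (conj_mul_eigenframe σ γ (r x.1) hP) hu hu1 hlt h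
  simp_rw [hterm]
  rw [Finset.sum_ite, Finset.sum_const, Finset.sum_const, smul_eq_mul, smul_eq_mul, mul_one]
  have hV : Nat.card (fixedBy (↥(unitaryGroupOfForm σ J) ⧸ (glInt 2 F).subgroupOf (unitaryGroupOfForm σ J)) γ) =
      (Finset.univ : Finset (fixedBy (↥(unitaryGroupOfForm σ J) ⧸ (glInt 2 F).subgroupOf (unitaryGroupOfForm σ J)) γ)).card := by
    rw [Nat.card_eq_fintype_card, Finset.card_univ]
  have hA : Nat.card {x : fixedBy (↥(unitaryGroupOfForm σ J) ⧸ (glInt 2 F).subgroupOf (unitaryGroupOfForm σ J)) γ //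
      ∀ i j, valuation F (((((x.1.out)⁻¹ * γ * x.1.out : ↥(unitaryGroupOfForm σ J)) : GL (Fin 2) F) : Matrix (Fin 2) (Fin 2) F) i j -
        (u 1 • (1 : Matrix (Fin 2) (Fin 2) F)) i j) < 1} =
      ((Finset.univ : Finset (fixedBy (↥(unitaryGroupOfForm σ J) ⧸ (glInt 2 F).subgroupOf (unitaryGroupOfForm σ J)) γ)).filter fun x =>
        ∀ i j, valuation F (((((x.1.out)⁻¹ * γ * x.1.out : ↥(unitaryGroupOfForm σ J)) : GL (Fin 2) F) : Matrix (Fin 2) (Fin 2) F) i j -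
          (u 1 • (1 : Matrix (Fin 2) (Fin 2) F)) i j) < 1).card := by
    rw [Nat.card_eq_fintype_card, Fintype.card_subtype]
  rw [hV, hA, ← Finset.card_filter_add_card_filter_not
    (s := (Finset.univ : Finset (fixedBy (↥(unitaryGroupOfForm σ J) ⧸ (glInt 2 F).subgroupOf (unitaryGroupOfForm σ J)) γ)))
    (fun x => ∀ i j, valuation F (((((x.1.out)⁻¹ * γ * x.1.out : ↥(unitaryGroupOfForm σ J)) : GL (Fin 2) F) : Matrix (Fin 2) (Fin 2) F) i j -
      (u 1 • (1 : Matrix (Fin 2) (Fin 2) F)) i j) < 1)]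
  ring

end Generic

end Literature.NumberTheory.Automorphic
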